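import Literature.NumberTheory.EllipticCurves.IwasawaAlgebraGroupRingLimit
import HarnessLib

/-!
# `Λ(ℤ/d × ℤ_p, S) = lim←_n S[ℤ/dp^nℤ] ≅ (S⟦X⟧)^{ℤ/d}`: compatible families on the cyclic groups `ℤ/dp^nℤ` (`p ∤ d`)
# are `ℤ/d`-tuples of power series (Chinese remainder + the algebraic Amice isomorphism componentwise)

Washington, *Introduction to Cyclotomic Fields* (1997), §7.1 Thm. 7.1; de Shalit, *Iwasawa theory of elliptic curves with complex
multiplication* (1987), Ch. I §3.1: for `𝒢 ≅ Δ × ℤ_p` with `Δ` finite of order prime to `p`, `ℤ_p⟦𝒢⟧ = Λ[Δ]`, `Λ = ℤ_p⟦S⟧`.  Here `𝒢` is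
PROCYCLIC: `𝒢 = lim← ℤ/dp^nℤ` with `p ∤ d` (the Galois group of an unramified tower of a local field whose degrees are `d·p^n` —
the shape of the unramified layers of the two-variable towers of de Shalit III §1.3, whose prime-to-`p` part `d` comes from the tame
level).  For a commutative ring `S` that is `(p)`-adically complete with `p` not a unit, a family of functions `a_n : ℤ/dp^nℤ → S` compatible
under push-forward along the projections `ℤ/dp^{n+1} ↠ ℤ/dp^n` is, through the Chinese remainder isomorphisms
`χ_n : ℤ/dp^n ≅ ℤ/d × ℤ/p^n` (which are compatible with the projections: `fst_chineseRemainder_castHom`, `snd_chineseRemainder_castHom`),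
the same as a `ℤ/d`-tuple of push-forward-compatible families on the `ℤ/p^n` (`pushforward_iff_pushforward_components`), hence
(`IwasawaAlgebraGroupRingLimit`) the same as a `ℤ/d`-tuple of power series:

* ★★ `existsUnique_forall_omega_dvd_sub_amice_prod` — a compatible family `a` has a UNIQUE transform `g : ℤ/d → S⟦X⟧` with
  `g j ≡ Σ_{x ∈ ℤ/p^n} a_n(χ_n⁻¹(j, x))·(1+X)^x (mod ω_n)` for all `n, j` (`ω_n = (1+X)^{p^n} − 1`);
* ★★★ `existsUnique_compatible_amice_prod` — conversely every `g : ℤ/d → S⟦X⟧` is the transform of a UNIQUE compatible family: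
  **`Λ(ℤ/d × ℤ_p, S) ≅ (S⟦X⟧)^{ℤ/d} = S[ℤ/d]⟦X⟧`**;
* ★ `omega_dvd_pow_mul_amice_sub_amice_translate` — **translation by `t` on `ℤ/dp^n` is (shift of the `ℤ/d`-index by `t`) ⊗
  (multiplication by `(1+X)^t`)**: the transform of `y ↦ a_n(y − t)` at `j` is `(1+X)^t · g(j − t)` modulo `ω_n` — so the generator `1`
  of `ℤ/dp^n` acts as `[1]·(1+X)` on `S[ℤ/d]⟦X⟧`, its `ℤ_p`-part as `1 + X` and its `ℤ/d`-part as the regular representation.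

Everything PROVED (0 sorry, no named facts, no new definitions).  Use (brick (c) of the BSD cell): the unramified half of the
`Λ`-structure of the Coleman coordinates along a GENERAL unramified tower (`[E_m : F] = d·p^m`), `LubinTateUnramifiedTowerIwasawaCyclic`.

## References

* L. C. Washington, *Introduction to Cyclotomic Fields*, 2nd ed. (1997), §7.1, Thm. 7.1. [Washington1997]
* E. de Shalit, *Iwasawa theory of elliptic curves with complex multiplication* (1987), Ch. I §3.1. [deShalit1987]
-/

noncomputable section

namespace Literature.NumberTheory.EllipticCurves

namespace IwasawaOmega

open Finset

variable {S : Type*} [CommRing S] (p : ℕ) [hp : Fact p.Prime] (d : ℕ) [NeZero d] (hd : d.Coprime p)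

/-! ### The Chinese remainder isomorphisms `χ_n : ℤ/dp^n ≅ ℤ/d × ℤ/p^n` are compatible with the projections -/

omit hp [NeZero d] in
/-- `d·p^n ∣ d·p^{n+1}`. [cite: Washington1997, §7.1 Theorem 7.1] -/
theorem mul_pow_dvd_mul_pow_succ (n : ℕ) : d * p ^ n ∣ d * p ^ (n + 1) :=
  mul_dvd_mul_left d (pow_dvd_pow p n.le_succ)

omit hp [NeZero d] in
/-- **The `ℤ/d`-component is unchanged by the projection** `ℤ/dp^{n+1} ↠ ℤ/dp^n`: `(χ_n(ȳ)).1 = (χ_{n+1}(y)).1`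
(ring homomorphisms out of `ℤ/Nℤ` are unique). [cite: deShalit1987, Ch. I §3.1] -/
theorem fst_chineseRemainder_castHom (n : ℕ) (y : ZMod (d * p ^ (n + 1))) :
    (ZMod.chineseRemainder (hd.pow_right n) (ZMod.castHom (mul_pow_dvd_mul_pow_succ p d n) (ZMod (d * p ^ n)) y)).1 =
      (ZMod.chineseRemainder (hd.pow_right (n + 1)) y).1 := by
  have h := RingHom.ext_zmod
    ((RingHom.fst (ZMod d) (ZMod (p ^ n))).comp ((ZMod.chineseRemainder (hd.pow_right n)).toRingHom.comp
      (ZMod.castHom (mul_pow_dvd_mul_pow_succ p d n) (ZMod (d * p ^ n)))))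
    ((RingHom.fst (ZMod d) (ZMod (p ^ (n + 1)))).comp (ZMod.chineseRemainder (hd.pow_right (n + 1))).toRingHom)
  exact RingHom.congr_fun h y

omit hp [NeZero d] in
/-- **The `ℤ/p^n`-component of the projection is the projection of the `ℤ/p^{n+1}`-component**: `(χ_n(ȳ)).2 = \overline{(χ_{n+1}(y)).2}`.
[cite: deShalit1987, Ch. I §3.1] -/
theorem snd_chineseRemainder_castHom (n : ℕ) (y : ZMod (d * p ^ (n + 1))) :
    (ZMod.chineseRemainder (hd.pow_right n) (ZMod.castHom (mul_pow_dvd_mul_pow_succ p d n) (ZMod (d * p ^ n)) y)).2 =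
      ZMod.castHom (pow_dvd_pow p n.le_succ) (ZMod (p ^ n)) (ZMod.chineseRemainder (hd.pow_right (n + 1)) y).2 := by
  have h := RingHom.ext_zmod
    ((RingHom.snd (ZMod d) (ZMod (p ^ n))).comp ((ZMod.chineseRemainder (hd.pow_right n)).toRingHom.comp
      (ZMod.castHom (mul_pow_dvd_mul_pow_succ p d n) (ZMod (d * p ^ n)))))
    ((ZMod.castHom (pow_dvd_pow p n.le_succ) (ZMod (p ^ n))).comp
      ((RingHom.snd (ZMod d) (ZMod (p ^ (n + 1)))).comp (ZMod.chineseRemainder (hd.pow_right (n + 1))).toRingHom))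
  exact RingHom.congr_fun h y

omit hp [NeZero d] in
/-- The projection in CRT coordinates: `χ_n(ȳ) = ((χ_{n+1} y).1, \overline{(χ_{n+1} y).2})`. [cite: deShalit1987, Ch. I §3.1] -/
theorem chineseRemainder_castHom (n : ℕ) (y : ZMod (d * p ^ (n + 1))) :
    ZMod.chineseRemainder (hd.pow_right n) (ZMod.castHom (mul_pow_dvd_mul_pow_succ p d n) (ZMod (d * p ^ n)) y) =
      ((ZMod.chineseRemainder (hd.pow_right (n + 1)) y).1,
        ZMod.castHom (pow_dvd_pow p n.le_succ) (ZMod (p ^ n)) (ZMod.chineseRemainder (hd.pow_right (n + 1)) y).2) :=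
  Prod.ext (fst_chineseRemainder_castHom p d hd n y) (snd_chineseRemainder_castHom p d hd n y)

omit hp [NeZero d] in
/-- The projection of `χ_{n+1}⁻¹(j, x')` is `χ_n⁻¹(j, x̄')`. [cite: deShalit1987, Ch. I §3.1] -/
theorem castHom_chineseRemainder_symm (n : ℕ) (j : ZMod d) (x' : ZMod (p ^ (n + 1))) :
    ZMod.castHom (mul_pow_dvd_mul_pow_succ p d n) (ZMod (d * p ^ n)) ((ZMod.chineseRemainder (hd.pow_right (n + 1))).symm (j, x')) =
      (ZMod.chineseRemainder (hd.pow_right n)).symm (j, ZMod.castHom (pow_dvd_pow p n.le_succ) (ZMod (p ^ n)) x') := by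
  rw [RingEquiv.eq_symm_apply, chineseRemainder_castHom p d hd n, RingEquiv.apply_symm_apply]

/-! ### Fibres of the projection in CRT coordinates -/

/-- **The fibre of `ℤ/dp^{n+1} ↠ ℤ/dp^n` over `χ_n⁻¹(j, x)` is `{χ_{n+1}⁻¹(j, x') : x̄' = x}`**: a sum over it is a sum over the fibre of
`ℤ/p^{n+1} ↠ ℤ/p^n` over `x`. [cite: deShalit1987, Ch. I §3.1] -/
theorem sum_fiber_castHom_eq_sum_fiber_component {M : Type*} [AddCommMonoid M] (n : ℕ) (b : ZMod (d * p ^ (n + 1)) → M)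
    (j : ZMod d) (x : ZMod (p ^ n)) :
    open scoped Classical in
    ∑ y ∈ univ.filter (fun y : ZMod (d * p ^ (n + 1)) =>
        ZMod.castHom (mul_pow_dvd_mul_pow_succ p d n) (ZMod (d * p ^ n)) y = (ZMod.chineseRemainder (hd.pow_right n)).symm (j, x)), b y =
      ∑ x' ∈ univ.filter (fun x' : ZMod (p ^ (n + 1)) => ZMod.castHom (pow_dvd_pow p n.le_succ) (ZMod (p ^ n)) x' = x),
        b ((ZMod.chineseRemainder (hd.pow_right (n + 1))).symm (j, x')) := by
  classical
  symm
  refine sum_bij' (fun x' _ => (ZMod.chineseRemainder (hd.pow_right (n + 1))).symm (j, x'))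
    (fun y _ => (ZMod.chineseRemainder (hd.pow_right (n + 1)) y).2) (fun x' hx' => ?_) (fun y hy => ?_) (fun x' _ => ?_)
    (fun y hy => ?_) (fun x' _ => rfl)
  · rw [mem_filter] at hx' ⊢
    exact ⟨mem_univ _, by rw [castHom_chineseRemainder_symm p d hd n, hx'.2]⟩
  · rw [mem_filter] at hy ⊢
    refine ⟨mem_univ _, ?_⟩
    rw [← snd_chineseRemainder_castHom p d hd n, hy.2, RingEquiv.apply_symm_apply]
  · rw [RingEquiv.apply_symm_apply]
  · rw [mem_filter] at hy
    have h1 : (ZMod.chineseRemainder (hd.pow_right (n + 1)) y).1 = j := by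
      rw [← fst_chineseRemainder_castHom p d hd n, hy.2, RingEquiv.apply_symm_apply]
    rw [← h1, Prod.mk.eta, RingEquiv.symm_apply_apply]

/-! ### Compatible families on the `ℤ/dp^n` ⟷ `ℤ/d`-tuples of compatible families on the `ℤ/p^n` -/

/-- ★ **Push-forward-compatibility in CRT coordinates**: a family `a_n : ℤ/dp^n → M` is compatible under push-forward along
`ℤ/dp^{n+1} ↠ ℤ/dp^n` iff for every `j ∈ ℤ/d` the component family `x ↦ a_n(χ_n⁻¹(j, x))` on the `ℤ/p^n` is compatible under
push-forward along `ℤ/p^{n+1} ↠ ℤ/p^n`. [cite: deShalit1987, Ch. I §3.1] -/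
theorem pushforward_iff_pushforward_components {M : Type*} [AddCommMonoid M] (n : ℕ) (a₁ : ZMod (d * p ^ n) → M)
    (a₂ : ZMod (d * p ^ (n + 1)) → M) :
    open scoped Classical in
    (∀ y₀ : ZMod (d * p ^ n), a₁ y₀ = ∑ y ∈ univ.filter (fun y : ZMod (d * p ^ (n + 1)) =>
        ZMod.castHom (mul_pow_dvd_mul_pow_succ p d n) (ZMod (d * p ^ n)) y = y₀), a₂ y) ↔
      ∀ (j : ZMod d) (x : ZMod (p ^ n)), a₁ ((ZMod.chineseRemainder (hd.pow_right n)).symm (j, x)) =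
        ∑ x' ∈ univ.filter (fun x' : ZMod (p ^ (n + 1)) => ZMod.castHom (pow_dvd_pow p n.le_succ) (ZMod (p ^ n)) x' = x),
          a₂ ((ZMod.chineseRemainder (hd.pow_right (n + 1))).symm (j, x')) := by
  classical
  constructor
  · intro h j x
    rw [h, sum_fiber_castHom_eq_sum_fiber_component p d hd]
  · intro h y₀
    obtain ⟨⟨j, x⟩, rfl⟩ := (ZMod.chineseRemainder (hd.pow_right n)).symm.surjective y₀
    rw [h, sum_fiber_castHom_eq_sum_fiber_component p d hd]

/-! ### The transform of a compatible family on the `ℤ/dp^n` -/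

/-- ★★ **A push-forward-compatible family `(a_n : ℤ/dp^n → S)` has a UNIQUE Amice transform `g : ℤ/d → S⟦X⟧`**,
`g j ≡ Σ_{x ∈ ℤ/p^n} a_n(χ_n⁻¹(j, x))·(1+X)^x (mod ω_n)` for all `n, j` (`S` `(p)`-adically complete).
[cite: Washington1997, §7.1 Theorem 7.1] -/
theorem existsUnique_forall_omega_dvd_sub_amice_prod [IsAdicComplete (Ideal.span {(p : S)}) S] (a : ∀ n, ZMod (d * p ^ n) → S)
    (ha : open scoped Classical in ∀ n (y₀ : ZMod (d * p ^ n)), a n y₀ = ∑ y ∈ univ.filter (fun y : ZMod (d * p ^ (n + 1)) =>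
      ZMod.castHom (mul_pow_dvd_mul_pow_succ p d n) (ZMod (d * p ^ n)) y = y₀), a (n + 1) y) :
    ∃! g : ZMod d → PowerSeries S, ∀ n (j : ZMod d), ((1 + PowerSeries.X : PowerSeries S) ^ p ^ n - 1) ∣
      g j - ∑ x : ZMod (p ^ n), PowerSeries.C (a n ((ZMod.chineseRemainder (hd.pow_right n)).symm (j, x))) *
        (1 + PowerSeries.X) ^ x.val := by
  classical
  have hj := fun j : ZMod d => existsUnique_forall_omega_dvd_sub_amice p
    (fun n (x : ZMod (p ^ n)) => a n ((ZMod.chineseRemainder (hd.pow_right n)).symm (j, x)))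
    fun n x => (pushforward_iff_pushforward_components p d hd n (a n) (a (n + 1))).mp (ha n) j x
  choose g hg using fun j => (hj j).exists
  exact ⟨g, fun n j => hg j n, fun g' hg' => funext fun j => (hj j).unique (fun n => hg' n j) (hg j)⟩

/-- ★★★ **Every `g : ℤ/d → S⟦X⟧` is the Amice transform of a UNIQUE push-forward-compatible family `(a_n : ℤ/dp^n → S)`**: with
`existsUnique_forall_omega_dvd_sub_amice_prod` this is the bijection `Λ(ℤ/d × ℤ_p, S) = lim←_n S[ℤ/dp^nℤ] ≅ (S⟦X⟧)^{ℤ/d} = S[ℤ/d]⟦X⟧`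
(`S` `(p)`-adically complete, `p` not a unit) — de Shalit's `ℤ_p⟦𝒢⟧ = Λ[Δ]` for procyclic `𝒢 ≅ ℤ/d × ℤ_p`.
[cite: deShalit1987, Ch. I §3.1] -/
theorem existsUnique_compatible_amice_prod [IsAdicComplete (Ideal.span {(p : S)}) S] (hI : Ideal.span {(p : S)} ≠ ⊤)
    (g : ZMod d → PowerSeries S) :
    open scoped Classical in
    ∃! a : ∀ n, ZMod (d * p ^ n) → S,
      (∀ n (y₀ : ZMod (d * p ^ n)), a n y₀ = ∑ y ∈ univ.filter (fun y : ZMod (d * p ^ (n + 1)) =>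
        ZMod.castHom (mul_pow_dvd_mul_pow_succ p d n) (ZMod (d * p ^ n)) y = y₀), a (n + 1) y) ∧
      ∀ n (j : ZMod d), ((1 + PowerSeries.X : PowerSeries S) ^ p ^ n - 1) ∣
        g j - ∑ x : ZMod (p ^ n), PowerSeries.C (a n ((ZMod.chineseRemainder (hd.pow_right n)).symm (j, x))) *
          (1 + PowerSeries.X) ^ x.val := by
  classical
  -- componentwise compatible families `b j`
  have hj := fun j : ZMod d => existsUnique_compatible_amice p hI (g j)
  choose b hb hbuniq using hj
  -- glue them through the CRT isomorphisms
  refine ⟨fun n y => b (ZMod.chineseRemainder (hd.pow_right n) y).1 n (ZMod.chineseRemainder (hd.pow_right n) y).2, ⟨?_, ?_⟩, ?_⟩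
  · intro n
    refine (pushforward_iff_pushforward_components p d hd n _ _).mpr fun j x => ?_
    simp only [RingEquiv.apply_symm_apply]
    exact (hb j).1 n x
  · intro n j
    simp only [RingEquiv.apply_symm_apply]
    exact (hb j).2 n
  · rintro a ⟨ha, hag⟩
    -- each component family of `a` is compatible with transform `g j`, hence equals `b j`
    have hcomp : ∀ j : ZMod d, (fun n (x : ZMod (p ^ n)) => a n ((ZMod.chineseRemainder (hd.pow_right n)).symm (j, x))) = b j :=
      fun j => hbuniq j _ ⟨fun n x => (pushforward_iff_pushforward_components p d hd n (a n) (a (n + 1))).mp (ha n) j x,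
        fun n => hag n j⟩
    funext n y
    obtain ⟨⟨j, x⟩, rfl⟩ := (ZMod.chineseRemainder (hd.pow_right n)).symm.surjective y
    simp only [RingEquiv.apply_symm_apply]
    exact (congrFun (congrFun (hcomp j) n) x :)

/-! ### Translation = (shift of the `ℤ/d`-index) ⊗ (multiplication by `(1+X)^t`) -/

omit hp [NeZero d] in
/-- `χ_n⁻¹(j, x) − t = χ_n⁻¹(j − t, x − t)` (`χ_n` is a ring isomorphism). [cite: deShalit1987, Ch. I §3.1] -/
theorem chineseRemainder_symm_sub_natCast (n : ℕ) (j : ZMod d) (x : ZMod (p ^ n)) (t : ℕ) :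
    (ZMod.chineseRemainder (hd.pow_right n)).symm (j, x) - t = (ZMod.chineseRemainder (hd.pow_right n)).symm (j - t, x - t) := by
  have e : ((j - t, x - t) : ZMod d × ZMod (p ^ n)) = (j, x) - (t : ZMod d × ZMod (p ^ n)) := by
    ext <;> simp
  rw [e, map_sub, map_natCast]

omit hp in
/-- `(1+X)^t·Σ_x b(x)(1+X)^x ≡ Σ_x b(x − t)(1+X)^x (mod ω_n)` on `ℤ/p^nℤ` (reindex `x ↦ x + t`; `(1+X)^{p^n} ≡ 1`).
[cite: Washington1997, §7.1 Theorem 7.1] -/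
theorem omega_dvd_pow_mul_amice_sub (n : ℕ) [NeZero (p ^ n)] (b : ZMod (p ^ n) → S) (t : ℕ) :
    ((1 + PowerSeries.X : PowerSeries S) ^ p ^ n - 1) ∣
      (1 + PowerSeries.X) ^ t * (∑ x : ZMod (p ^ n), PowerSeries.C (b x) * (1 + PowerSeries.X) ^ x.val) -
        ∑ x : ZMod (p ^ n), PowerSeries.C (b (x - t)) * (1 + PowerSeries.X) ^ x.val := by
  -- reindex the second sum by `x ↦ x + t`
  have e : (∑ x : ZMod (p ^ n), PowerSeries.C (b (x - t)) * (1 + PowerSeries.X) ^ x.val) =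
      ∑ x : ZMod (p ^ n), PowerSeries.C (b x) * (1 + PowerSeries.X) ^ (x + t).val :=
    Fintype.sum_equiv (Equiv.subRight (t : ZMod (p ^ n))) _ _ fun x => by
      simp only [Equiv.subRight_apply, sub_add_cancel]
  rw [e, mul_sum, ← sum_sub_distrib]
  refine dvd_sum fun x _ => ?_
  have hv : (x + t : ZMod (p ^ n)).val = (x.val + t) % p ^ n := by
    rw [ZMod.val_add, ZMod.val_natCast, Nat.add_mod_mod]
  have e2 : (1 + PowerSeries.X : PowerSeries S) ^ t * (PowerSeries.C (b x) * (1 + PowerSeries.X) ^ x.val) -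
      PowerSeries.C (b x) * (1 + PowerSeries.X) ^ (x + t).val =
      PowerSeries.C (b x) * ((1 + PowerSeries.X) ^ (x.val + t) - (1 + PowerSeries.X) ^ ((x.val + t) % p ^ n)) := by
    rw [hv, pow_add, mul_sub]; ring
  rw [e2]
  exact Dvd.dvd.mul_left (omega_dvd_one_add_X_pow_sub p n (x.val + t)) _

omit [NeZero d] in
/-- ★ **Translation by `t` is (shift of the `ℤ/d`-index by `t`) ⊗ (multiplication by `(1+X)^t`)**: if `g : ℤ/d → S⟦X⟧` is the
transform of `a_n` (level `n`, CRT congruences at every `j`), then the transform of the translate `y ↦ a_n(y − t)` at `j` is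
`(1+X)^t · g(j − t)` modulo `ω_n`.  So on `Λ(ℤ/d × ℤ_p, S) ≅ S[ℤ/d]⟦X⟧` the generator `1 ∈ ℤ/dp^n` acts as `[1]·(1+X)`: its
`ℤ_p`-component as `1 + X`, its `ℤ/d`-component through the regular representation of `ℤ/d`.
[cite: deShalit1987, Ch. I §3.1] -/
theorem omega_dvd_pow_mul_amice_sub_amice_translate (n : ℕ) (a : ZMod (d * p ^ n) → S) (g : ZMod d → PowerSeries S)
    (hg : ∀ j : ZMod d, ((1 + PowerSeries.X : PowerSeries S) ^ p ^ n - 1) ∣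
      g j - ∑ x : ZMod (p ^ n), PowerSeries.C (a ((ZMod.chineseRemainder (hd.pow_right n)).symm (j, x))) *
        (1 + PowerSeries.X) ^ x.val) (t : ℕ) (j : ZMod d) :
    ((1 + PowerSeries.X : PowerSeries S) ^ p ^ n - 1) ∣
      (1 + PowerSeries.X) ^ t * g (j - t) - ∑ x : ZMod (p ^ n),
        PowerSeries.C (a ((ZMod.chineseRemainder (hd.pow_right n)).symm (j, x) - t)) * (1 + PowerSeries.X) ^ x.val := by
  haveI : NeZero (p ^ n) := ⟨pow_ne_zero _ hp.out.ne_zero⟩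
  have e : (∑ x : ZMod (p ^ n), PowerSeries.C (a ((ZMod.chineseRemainder (hd.pow_right n)).symm (j, x) - t)) *
      (1 + PowerSeries.X) ^ x.val) = ∑ x : ZMod (p ^ n),
        PowerSeries.C (a ((ZMod.chineseRemainder (hd.pow_right n)).symm (j - t, x - t))) * (1 + PowerSeries.X) ^ x.val :=
    sum_congr rfl fun x _ => by rw [chineseRemainder_symm_sub_natCast p d hd]
  rw [e]
  have h1 := (hg (j - t)).mul_left ((1 + PowerSeries.X : PowerSeries S) ^ t)
  rw [mul_sub] at h1
  have h2 := omega_dvd_pow_mul_amice_sub p n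
    (fun x : ZMod (p ^ n) => a ((ZMod.chineseRemainder (hd.pow_right n)).symm (j - t, x))) t
  have h3 := dvd_add h1 h2
  rwa [sub_add_sub_cancel] at h3

end IwasawaOmega

end Literature.NumberTheory.EllipticCurves
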